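/-
Origin: expansion seat `planner-pub-hodgecm-pv08-g6-0`, handover #1 2026-08-18T08:24:34Z (`HOME/pub-hodgecm-pv08-g6/lean/Pv08g6/S5QautSeesawArch.lean`, md5 27017f60, 856 lines);
landed by the gen-7 packager in gate run 26 as `HodgeCM/PerL34/S5QautSeesawArch.lean` (verbatim).
-/
/-
Origin: HOME/pub-hodgecm-pv08-g6/lean/Pv08g6/S5QautSeesawArch.lean — session planner-pub-hodgecm-pv08-g6-0 (unit
pub-hodgecm-pv08-g6, DAG-NODE PROVER #08 gen 6).  LEMMAS.md v13 §9 **seam S5**, `N19g`/(34) half — adv2g12-O4 REPAIR (ii):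
PerL v5 ll. 362–364 ("`θ(φ_j,χ′_j)` … vanishes unless that type occurs in `J⁺ ⊠ 𝟏`") KERNEL inside the lattice-shell record.
Intended final place: `HodgeCM/PerL34/S5QautSeesawArch.lean`.  NEW, ADDITIVE LEAF: imports LANDED (gate run 25) tree modules
only (`HodgeCM.PerL34.S5QautSeesawConservative` = pv08-g5 F4, `HodgeCM.PerL34.ArchAFock` = pv02-g4) — NO import rewrite.
New namespace `HodgeCM.PerL34.QautSeesawArch`.  Asserts nothing: no axiom, no placeholder proof, no print claim.
-/
import Summits.HodgeConjecture.HodgeCM.PerL34.S5QautSeesawConservative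
import Summits.HodgeConjecture.HodgeCM.PerL34.ArchAFock_2

/-!
# Seam S5, `N19g` half: the pure types outside `J⁺ ⊠ 𝟏` lift to `0` — KERNEL (adv2g12-O4, repair (ii))

VERBATIM (PerL v5 `paper.tex`):

* ll. 359–364: "By continuity of `ϑ_{T,χ₁₂}` it suffices to treat `Φ ∈ pr_κ(𝒫)`, which are finite sums of
  `pr_κ(φ₁⊗φ₂)` with `φ_j ∈ 𝒮((V₃⊗W_j)(𝔸))` Fock polynomials of pure `K_∞`-types (Lemma 3.4: `𝒫 = 𝒫₁ ⊗ 𝒫₂`).  By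
  (eq:seesaw), `ϑ_{T,χ₁₂}(pr_κ(φ₁⊗φ₂)) = pr_κ(θ(φ₁,χ′₁)θ(φ₂,χ′₂))`, and `θ(φ_j,χ′_j) ∈ π_j` has the `K_∞`-type of `φ_j`,
  hence vanishes unless that type occurs in `J⁺ ⊠ 𝟏`, the common archimedean component of the constituents of the closure
  of `π_j` (Definition 3.2)."
* ll. 474–476 (§4.1): "let `𝓕_{i,b}` be the Fock model of `ω_{W_i,b}` and `φ⁰_{i,b} ∈ 𝓕_{i,b}` a generator of the isotypic
  component of `𝟏_{U(3)}` (`b ≠ ι₁`; it is the vacuum line, [Y1neg, Lemma 3.2]) resp. the harmonic `z₁` generating `J⁺`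
  (`b = ι₁`, [Y1neg, Lemma 3.1]); `U(W_{i,b}) = U(1)` acts on it by a character `u ↦ u^{-e_b(Ψ_i)}`, which DEFINES
  `e_b(Ψ_i) ∈ ℤ`."
* ll. 425–427 (Prop. 3.6, Step 2): "(for `ξ_∞ ≠ w` they vanish for weight reasons …) `(χ′₁,χ′₂) := ξ` is then a pair of
  automorphic characters of the forced archimedean types".

WHAT THIS FILE DOES.  pv08-g5's lattice-shell record `QautSeesaw.QautSeesawBridge` (F3, `S5QautSeesaw.lean`, run 25)
carries ONE dictionary field `ϑ_pr` whose label bundles three sentences: (D4/D5) `Φ ∈ P = pr_κ(𝒫₁ ⊗ 𝒫₂)` is `pr_κ` of a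
finite sum of pure tensors; (ll. 362–364) the pure types outside `J⁺ ⊠ 𝟏` lift to `0`, so only ADMISSIBLE (`J⁺ ⊠ 𝟏`-typed)
pure tensors need be kept; (l. 372) `pr_κ` commutes with `ϑ_{T,χ}`.  Objection adv2g12-O4 asked that the middle sentence —
the `U(1)`-weight tautology of node N27 — be COMPUTED, not carried in the label ("repair (ii): state the field for pure
tensors of ALL pure types and derive the vanishing of the off-type terms").  This file does exactly that:

* §1 (KERNEL, shell level, over pv11's `Seesaw.ThetaSeesawData`): **`integral_mul_eq_zero_of_weight`** /
  **`thetaLift₁_eq_zero_of_weight`**, **`thetaLift₂_eq_zero_of_weight`** — if a circle `c ↦ r c` acts on `U(W_j)(𝔸)`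
  leaving the period integral `∫ θ_φ(g,u) χ′_j(u) dν_j(u)` invariant, `χ′_j(r c u) = χ′_j(u)·c^e`, and
  `ω_j(g, r c u) φ = ω_j(g,u) φ_c` with `θ(φ_c, χ′_j) = c^k · θ(φ, χ′_j)`, then `k ≠ -e ⟹ θ(φ, χ′_j) = 0` (Schur
  orthogonality on `U(1)`; the torus-side form of PerL's sentence = node N27, cf. `ArchA.LineArchData.N27_converse`, here
  for pv11's scalar shell, which has no group structure on `A_j`).
* §2 (KERNEL, Fock side): the `J⁺`-projection **`projJ : ℂ[z₁,z₂,w] →ₗ J⁺`** (the weight-`1` homogeneous component for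
  pv12's `uWt`, (F2)/(F3)), `projJ_coe`, and **`apply_eq_apply_projJ`**: a linear map killing every `F_k = hpiece k`,
  `k ≠ 1`, factors through `projJ`; `projJ` commutes with every endomorphism preserving the pieces (`projJ_comm`), in
  particular with pv14's `K_{ι₁}`-action `fockRep` (`projJ_fockRep`) and with pv02-g4's circle `Fock.harmCircle k₀`
  (`projJ_harmCircle`).
* §3 the WIDENED record **`QautSeesawArchBridge T V c D k l`**: F3's record with (a) the `ι₁` Fock factor widened from
  `J⁺ = jplusSubmodule` to ALL of pv12's `Fock.HarmModel = ℂ[z₁,z₂,w]` (`embH_j`, `thetaH_j`, `integrableH_j` for every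
  Fock polynomial — l. 335 "all integrals over compact sets of continuous functions"); (b) the away data `Away_j` = pure
  tensors of PURE `U(W_{j,b})`-TYPES at the real places `b ≠ ι₁` (`Pl`), with their weights `wt_j b a ∈ ℤ`, and
  ADMISSIBILITY DEFINED (no longer an opaque predicate): `a` is admissible iff its weight at every `b ≠ ι₁` is the vacuum
  weight `-e_b` (ll. 474–476 DEFINE `e_b` this way); (c) per real place a circle on `U(W_j)(𝔸)` (`rι_j`, `r_j b`:
  STRUCTURAL D4′ — `U(W_j)(L₀ ⊗_b ℝ) = U(1) ⊂ U(W_j)(𝔸)` acting by translation), invariance of the period integral under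
  it (`period_rι_j`, `period_r_j`: STRUCTURAL — the Haar measure of the automorphic quotient `[U(W_j)]` is translation
  invariant and `u ↦ θ_φ(g,u)χ′_j(u)` is a function on the quotient), the archimedean type of `χ′_j` for an allowed `χ`
  (`ch_rι_j`, `ch_r_j`: DICTIONARY D1 + ll. 425–427 "of the forced archimedean types" + ll. 474–476; at `ι₁` the exponent
  is `-(1 + k₀_j)` because `J⁺ = F_1` is the weight-`(1 + k₀_j)` space of `harmCircle k₀_j` — pv02-g4
  `Fock.weightSpace_harmCircle_one_add`, [BW] VIII 2.8/2.14), and the covariance of `ω_j` (`omega_rι_j`, `omega_r_j`: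
  STRUCTURAL D4 — `ω_j` is a representation of `G_U × U(W_j)(𝔸)` whose archimedean circle at `ι₁` acts on the Fock
  factor by pv02-g4's `Fock.harmCircle k₀_j` ([Adams07 §2] = pv12 (F2) `uWt` + vacuum twist `k₀_j`) and at `b ≠ ι₁` on the
  pure type `a` by `c^{wt_j b a}`); (d) the dictionary field **`ϑ_pr`** now for pure tensors of ALL pure types — its label is
  D4/D5 (`Φ ∈ P = pr_κ(𝒫₁⊗𝒫₂)`, Lemma 3.4 / pv12 `Fock.pairMap_bijective`) + l. 372 (`pr_κ ∘ ϑ_{T,χ} = ϑ_{T,χ} ∘ pr_κ`)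
  ONLY; ll. 362–364 have LEFT the label.
* §4 (KERNEL over the record): **`thetaH_eq_zero_of_mem_hpiece`** (at `ι₁`: `F_k`, `k ≠ 1`, lifts to `0`),
  **`thetaH_eq_zero_of_wt`** (away: a non-vacuum weight at some `b ≠ ι₁` lifts to `0`), **`thetaH_apply_eq_thetaJ_projJ`**
  (`θ(p⊗a,χ′) = θ(projJ p ⊗ a, χ′)`), and the constructor **`toSeesawBridge : QautSeesawArchBridge … → QautSeesawBridge …`**
  in which F3's `ϑ_pr` (admissible `J⁺`-expansion) is DERIVED: expand, discard the off-type terms in the kernel, project the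
  `ι₁` factor to `J⁺`, re-index.  Corollaries by name: `N19g_core_of_archBridge`, `nonempty_seesawBridge_of_archBridge`,
  `open_thetaReal34_of_archBridges`.
* §5 (STRENGTH, census): **`nonempty_archBridge_iff : Nonempty (QautSeesawArchBridge …) ↔ N19g_core …`** — the widened
  record is still CONSERVATIVE over the leaf (junk widening of ANY F3 record with trivially-true admissibility, e.g. F4's:
  no real place away from `ι₁`, `k₀_j := -1`, trivial circles; §2's `projJ_harmCircle` / `projJ_fockRep` make the junk
  honest-to-type), and the binder-level `archBridges_iff_core`.  READING: as for F3/F4, moving ll. 362–364 from a label to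
  a theorem did not smuggle in strength; what changed is which sentences of Lemma 3.5's proof are computed.

ON THE ARGUMENT.  PerL's own sentence argues through the `K_∞`-type of `θ(φ_j,χ′_j) ∈ π_j` (Howe duality + Def. 3.2).  The
kernel proof here is the torus-side form of the same tautology (LEMMAS node N27, ll. 425–427 "vanish for weight reasons"):
the `U(W_{j,b})`-weight of `φ_j` must be `-e_b(χ′_j)` at every real `b` or the `[U(W_j)]`-integral against `χ′_j` vanishes,
which needs only the archimedean type of `χ′_j` and translation invariance of the period — not Howe duality.  In the Fock
models the two conditions coincide: at `ι₁` the `K_{ι₁}`-types separate the pieces `F_k` (pv05-g3/pv12 (F2)–(F3)) and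
`J⁺ = F_1`; at `b ≠ ι₁` "`U(3)`-invariant" = the vacuum line = the vacuum weight (pv05-g3 `Fock.mem_dpiece_zero_iff`, pv02-g4
`Fock.mem_weightSpace_defCircle_self_iff`).

VACUITY / BOUNDARY.  Nothing is cited; every non-kernel sentence is a FIELD of the record with its label above, exactly as in
F3; the record is inhabited from the leaf (§5), so no field is contradictory relative to `N19g_core`.  `PerL`, `QW8` and
the 2001 programme are not invoked.

Unit `pub-hodgecm-pv08-g6`, 2026-08-18.  Fully kernel-checked; standard axiom trio.
-/

set_option autoImplicit false

noncomputable section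

open MeasureTheory Matrix MvPolynomial
open HodgeCM.Prior.Perl34File
open HodgeCM.PerL34.Qaut (pr prL prL_apply wedge)
open HodgeCM.PerL34.P43KTypesU2 (Jplus Jplus_apply_coe fockRep fockRep_apply jplusSubmodule mem_jplusSubmodule
  isWeightedHomogeneous_substHom)
open HodgeCM.PerL34.QautFock (pPlusMat continuous_pPlusMat isUnit_det_pPlusMat formOf QautFockBridge
  N19g_core_of_fockBridge open_thetaReal34_of_fockBridges)
open HodgeCM.PerL34.Seesaw
open HodgeCM.PerL34.QautSeesaw (QautSeesawBridge thetaPeriod_sum_tmul N19g_core_of_seesawBridge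
  open_thetaReal34_of_seesawBridges)

namespace HodgeCM
namespace PerL34
namespace QautSeesawArch

/-! ## §1. The `U(1)`-weight vanishing over pv11's scalar shell (node N27, torus side) — KERNEL -/

section Weight

/-- **Schur orthogonality on `U(1)`, integral form.**  `K φ` = the theta kernel `u ↦ θ_φ(g,u)` of a vector `φ`, `χ` the
character, `r c` the translation of `U(W_j)(𝔸)` by the archimedean circle: if the period `∫ K χ dν` is translation
invariant, `χ` has type `e` under the circle, and translating `φ` multiplies its period by `c^k`, then `k ≠ -e` forces
the period to vanish. -/
theorem integral_mul_eq_zero_of_weight {A S : Type*} [MeasurableSpace A] (ν : Measure A) (χ : A → ℂ)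
    (K : S → A → ℂ) (r : Circle → A → A) (e k : ℤ) (φ : S) (ψ : Circle → S)
    (hinv : ∀ c, ∫ u, K φ (r c u) * χ (r c u) ∂ν = ∫ u, K φ u * χ u ∂ν)
    (hχ : ∀ c u, χ (r c u) = χ u * (c : ℂ) ^ e)
    (hK : ∀ c u, K φ (r c u) = K (ψ c) u)
    (hlin : ∀ c, ∫ u, K (ψ c) u * χ u ∂ν = (c : ℂ) ^ k * ∫ u, K φ u * χ u ∂ν)
    (hk : k ≠ -e) : ∫ u, K φ u * χ u ∂ν = 0 := by
  obtain ⟨c, hc⟩ := ArchA.exists_zpow_ne_one (n := k + e) (by omega)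
  have key : (c : ℂ) ^ (k + e) * ∫ u, K φ u * χ u ∂ν = ∫ u, K φ u * χ u ∂ν := by
    calc (c : ℂ) ^ (k + e) * ∫ u, K φ u * χ u ∂ν
        = ((c : ℂ) ^ k * ∫ u, K φ u * χ u ∂ν) * (c : ℂ) ^ e := by
          rw [zpow_add₀ (Circle.coe_ne_zero c)]; ring
      _ = (∫ u, K (ψ c) u * χ u ∂ν) * (c : ℂ) ^ e := by rw [hlin c]
      _ = ∫ u, K (ψ c) u * χ u * (c : ℂ) ^ e ∂ν := (integral_mul_const _ _).symm
      _ = ∫ u, K φ (r c u) * χ (r c u) ∂ν := by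
          refine integral_congr_ae (Filter.Eventually.of_forall fun u => ?_)
          simp only [hK c u, hχ c u, mul_assoc]
      _ = ∫ u, K φ u * χ u ∂ν := hinv c
  have h0 : ((c : ℂ) ^ (k + e) - 1) * ∫ u, K φ u * χ u ∂ν = 0 := by
    rw [sub_mul, one_mul, key, sub_self]
  rcases mul_eq_zero.mp h0 with h | h
  · exact absurd (sub_eq_zero.mp h) hc
  · exact h

/-- A measure-preserving measurable embedding leaves every integral invariant — the convenient sufficient condition for
the invariance hypothesis `hinv` (e.g. `A` = the compact quotient `[U(W_j)]` with its Haar measure). -/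
theorem integral_comp_eq_of_measurePreserving {A : Type*} [MeasurableSpace A] (ν : Measure A) (r : A → A)
    (hr : MeasurePreserving r ν ν) (hre : MeasurableEmbedding r) (F : A → ℂ) :
    ∫ u, F (r u) ∂ν = ∫ u, F u ∂ν :=
  hr.integral_comp hre F

variable (DS : ThetaSeesawData)

/-- **ll. 362–364 / N27 for side 1 of pv11's shell — KERNEL.**  `ω₁(g, r c u) φ = ω₁(g, u) (ψ c)` (the circle acts on
`φ` through `ψ`), `θ(ψ c, χ₁) = c^k θ(φ, χ₁)` (weight `k`), `χ₁` of type `e`, period translation invariant: `k ≠ -e ⟹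
θ(φ, χ₁)(g) = 0`. -/
theorem thetaLift₁_eq_zero_of_weight [MeasurableSpace DS.A₁] (ν : Measure DS.A₁) (χ₁ : DS.A₁ → ℂ)
    (r : Circle → DS.A₁ → DS.A₁) (e k : ℤ) (φ : DS.S₁) (ψ : Circle → DS.S₁) (g : DS.G)
    (hinv : ∀ c, ∫ u, DS.thetaKernel₁ φ g (r c u) * χ₁ (r c u) ∂ν = ∫ u, DS.thetaKernel₁ φ g u * χ₁ u ∂ν)
    (hχ : ∀ c u, χ₁ (r c u) = χ₁ u * (c : ℂ) ^ e)
    (hω : ∀ c u, DS.ω₁ g (r c u) φ = DS.ω₁ g u (ψ c))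
    (hlin : ∀ c, DS.thetaLift₁ ν χ₁ (ψ c) g = (c : ℂ) ^ k * DS.thetaLift₁ ν χ₁ φ g)
    (hk : k ≠ -e) : DS.thetaLift₁ ν χ₁ φ g = 0 :=
  integral_mul_eq_zero_of_weight ν χ₁ (fun φ' u => DS.thetaKernel₁ φ' g u) r e k φ ψ hinv hχ
    (fun c u => by simp only [ThetaSeesawData.thetaKernel₁, hω c u]) hlin hk

/-- side 2, see `thetaLift₁_eq_zero_of_weight` -/
theorem thetaLift₂_eq_zero_of_weight [MeasurableSpace DS.A₂] (ν : Measure DS.A₂) (χ₂ : DS.A₂ → ℂ)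
    (r : Circle → DS.A₂ → DS.A₂) (e k : ℤ) (φ : DS.S₂) (ψ : Circle → DS.S₂) (g : DS.G)
    (hinv : ∀ c, ∫ u, DS.thetaKernel₂ φ g (r c u) * χ₂ (r c u) ∂ν = ∫ u, DS.thetaKernel₂ φ g u * χ₂ u ∂ν)
    (hχ : ∀ c u, χ₂ (r c u) = χ₂ u * (c : ℂ) ^ e)
    (hω : ∀ c u, DS.ω₂ g (r c u) φ = DS.ω₂ g u (ψ c))
    (hlin : ∀ c, DS.thetaLift₂ ν χ₂ (ψ c) g = (c : ℂ) ^ k * DS.thetaLift₂ ν χ₂ φ g)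
    (hk : k ≠ -e) : DS.thetaLift₂ ν χ₂ φ g = 0 :=
  integral_mul_eq_zero_of_weight ν χ₂ (fun φ' u => DS.thetaKernel₂ φ' g u) r e k φ ψ hinv hχ
    (fun c u => by simp only [ThetaSeesawData.thetaKernel₂, hω c u]) hlin hk

end Weight

/-! ## §2. The `J⁺`-projection of pv12's Fock model `ℂ[z₁,z₂,w]` — KERNEL -/

section Proj

open Fock

/-- the weight-`n` component for pv12's `U(1)_W`-weights `uWt` ((F2): `z_a ↦ 1`, `w ↦ -1`) -/
abbrev comp (n : ℤ) : HarmModel →ₗ[ℂ] HarmModel := weightedHomogeneousComponent uWt n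

/-- (Ported verbatim from the HodgeCMPerL package; no docstring in the source.) -/
theorem comp_mem_hpiece (n : ℤ) (f : HarmModel) : comp n f ∈ hpiece n := by
  rw [hpiece, wpiece_eq_weightedHomogeneousSubmodule]
  exact weightedHomogeneousComponent_mem uWt f n

/-- (Ported verbatim from the HodgeCMPerL package; no docstring in the source.) -/
theorem comp_of_mem_hpiece {m n : ℤ} {f : HarmModel} (hf : f ∈ hpiece n) :
    comp m f = if m = n then f else 0 := by
  rw [hpiece, wpiece_eq_weightedHomogeneousSubmodule] at hf
  exact weightedHomogeneousComponent_of_mem hf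

/-- the finite set of weights occurring in `f` -/
theorem sum_comp (f : HarmModel) :
    ∑ n ∈ (weightedHomogeneousComponent_finsupp (w := uWt) f).toFinset, comp n f = f := by
  rw [← finsum_eq_sum _ (weightedHomogeneousComponent_finsupp f)]
  exact sum_weightedHomogeneousComponent uWt f

/-- (Ported verbatim from the HodgeCMPerL package; no docstring in the source.) -/
theorem jplusSubmodule_eq_hpiece_one : jplusSubmodule = hpiece 1 := by
  ext f
  rw [mem_jplusSubmodule, inJplus_iff]

/-- **The `J⁺`-projection** `ℂ[z₁,z₂,w] → J⁺ = F_1`: the `uWt`-weight-`1` homogeneous component. -/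
def projJ : HarmModel →ₗ[ℂ] jplusSubmodule :=
  LinearMap.codRestrict jplusSubmodule (comp 1) fun f => by
    rw [jplusSubmodule_eq_hpiece_one]
    exact comp_mem_hpiece 1 f

/-- (Ported verbatim from the HodgeCMPerL package; no docstring in the source.) -/
@[simp] theorem projJ_apply_coe (f : HarmModel) : ((projJ f : jplusSubmodule) : HarmModel) = comp 1 f := rfl

/-- `projJ` is the identity on `J⁺` -/
theorem projJ_coe (p : jplusSubmodule) : projJ (p : HarmModel) = p := by
  apply Subtype.ext
  have hp : (p : HarmModel) ∈ hpiece 1 := jplusSubmodule_eq_hpiece_one ▸ p.2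
  rw [projJ_apply_coe, comp_of_mem_hpiece hp, if_pos rfl]

/-- **A linear map killing every `F_k`, `k ≠ 1`, factors through the `J⁺`-projection.** -/
theorem apply_eq_apply_projJ {N : Type*} [AddCommGroup N] [Module ℂ N] (Λ : HarmModel →ₗ[ℂ] N)
    (hΛ : ∀ k : ℤ, k ≠ 1 → ∀ f ∈ hpiece k, Λ f = 0) (f : HarmModel) :
    Λ f = Λ ((projJ f : jplusSubmodule) : HarmModel) := by
  rw [projJ_apply_coe]
  conv_lhs => rw [← sum_comp f]
  rw [map_sum, Finset.sum_eq_single (1 : ℤ)]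
  · intro n _ hn
    exact hΛ n hn _ (comp_mem_hpiece n f)
  · intro h1
    have : comp 1 f = 0 := by
      simpa only [Set.Finite.mem_toFinset, Function.mem_support, ne_eq, not_not] using h1
    rw [this, map_zero]

/-- **`projJ` commutes with every endomorphism preserving the weight pieces.** -/
theorem comp_one_comm (E : HarmModel →ₗ[ℂ] HarmModel) (hE : ∀ (n : ℤ), ∀ f ∈ hpiece n, E f ∈ hpiece n)
    (f : HarmModel) : comp 1 (E f) = E (comp 1 f) := by
  conv_lhs => rw [← sum_comp f]
  rw [map_sum, map_sum, Finset.sum_eq_single (1 : ℤ)]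
  · rw [comp_of_mem_hpiece (hE 1 _ (comp_mem_hpiece 1 f)), if_pos rfl]
  · intro n _ hn
    rw [comp_of_mem_hpiece (hE n _ (comp_mem_hpiece n f)), if_neg (Ne.symm hn)]
  · intro h1
    have : comp 1 f = 0 := by
      simpa only [Set.Finite.mem_toFinset, Function.mem_support, ne_eq, not_not] using h1
    rw [this, map_zero, map_zero]

/-- (Ported verbatim from the HodgeCMPerL package; no docstring in the source.) -/
theorem projJ_comm (E : HarmModel →ₗ[ℂ] HarmModel) (hE : ∀ (n : ℤ), ∀ f ∈ hpiece n, E f ∈ hpiece n)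
    (hE₁ : ∀ f ∈ jplusSubmodule, E f ∈ jplusSubmodule) (f : HarmModel) :
    projJ (E f) = ⟨E (projJ f), hE₁ _ (projJ f).2⟩ :=
  Subtype.ext (comp_one_comm E hE f)

/-- pv14's `K_{ι₁}`-action preserves every piece `F_k` (it is weighted-homogeneous of weight `0`: pv14-g3
`isWeightedHomogeneous_substHom`). -/
theorem fockRep_mem_hpiece (y : P43KTypesU2.K) {n : ℤ} {f : HarmModel} (hf : f ∈ hpiece n) :
    fockRep y f ∈ hpiece n := by
  rw [hpiece, wpiece_eq_weightedHomogeneousSubmodule, mem_weightedHomogeneousSubmodule] at hf ⊢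
  rw [fockRep_apply, smul_eq_C_mul]
  exact (isWeightedHomogeneous_substHom y hf).C_mul _

/-- **`projJ` is `K_{ι₁}`-equivariant**: `projJ (k·f) = Jplus k (projJ f)`. -/
theorem projJ_fockRep (y : P43KTypesU2.K) (f : HarmModel) : projJ (fockRep y f) = Jplus y (projJ f) := by
  apply Subtype.ext
  rw [Jplus_apply_coe, projJ_apply_coe, projJ_apply_coe]
  exact comp_one_comm (fockRep y) (fun n f hf => fockRep_mem_hpiece y hf) f

/-- **`projJ` and pv02-g4's circle**: `projJ (harmCircle k₀ c f) = c^{1+k₀} · projJ f` (`J⁺ = F_1` has weight `1 + k₀`). -/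
theorem projJ_harmCircle (k₀ : ℤ) (c : Circle) (f : HarmModel) :
    projJ (harmCircle k₀ c f) = ((c : ℂ) ^ (1 + k₀)) • projJ f := by
  apply Subtype.ext
  rw [projJ_apply_coe, Submodule.coe_smul, projJ_apply_coe,
    comp_one_comm (harmCircle k₀ c) (fun n f hf => ?_) f, harmCircle_apply_of_mem_hpiece k₀ (comp_mem_hpiece 1 f) c]
  rw [harmCircle_apply_of_mem_hpiece k₀ hf c]
  exact Submodule.smul_mem _ _ hf

end Proj

/-! ## §3. The widened S5 record: pure tensors of ALL pure types -/

variable {U : Universe} (T : U.ThetaModel)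
variable {L : CMField} {ι₁ : L →+* ℂ} (V : HermSpace3 L ι₁) (c : SeesawCtx L)
variable (D : Perl34.TorusData (T.core V c)) (k l : Fin 4)


-- port_pkg: scope closed for this part
end QautSeesawArch
end PerL34
end HodgeCM
end
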